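import Literature.AlgebraicGeometry.Resolution.ValuationRingOpenInNormalization
import Mathlib.RingTheory.Valuation.LocalSubring
import Mathlib.RingTheory.IntegralClosure.IntegrallyClosed
import Mathlib.Order.KrullDimension
import Mathlib.FieldTheory.Minpoly.Field
import HarnessLib

/-!
# A valuation ring of a finite extension is open in the normalization — proofs

Topic: `Literature/AlgebraicGeometry/Resolution`. PROVED companion of
`ValuationRingOpenInNormalization.lean`: we discharge the named fact
`Temkin2013_valuationRingOpen` vendored there (M. Temkin, *Inseparable local uniformization*,
J. Algebra 373 (2013) 65–119 = arXiv:0804.1554v3, proof of Thm. 4.1.1, Step 3, p. 49: "Recall that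
`Sᵢ` is open in `Nr_{mᵢ}(S)` (this is even true for any valuation ring of finite height)"), i.e.
the classical statement (N. Bourbaki, *Algèbre commutative*, Ch. VI, §8, no. 6, Prop. 6, as cited
in R. Datta, Math. Nachr. 296 (2023) = arXiv:2101.08337, p. 8: "For the bijection see [Bou98,
Chap. VI, §8.6, Prop. 6]. If `L/K` is finite, then `A` has finitely many maximal ideals by part (1)
of Proposition 3.6": for a finite extension `l/k` and a valuation ring `k°` of `k`, the valuation
rings of `l` over `k°` are finitely many, pairwise incomparable, and are the localizations of the
integral closure `N = Nr_l(k°)` at its maximal ideals) in the form used by Temkin: if moreover `k°`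
has finite height then `W = N[1/f]` for some `f ∈ N ∩ W^×`.

## The proof (valuation-theoretic throughout; everything PROVED, no new definitions)

Write `𝒰` for the set of valuation rings `U` of `l` containing (the image of) `k°`, and recall
that `N = ⋂ 𝒰` (Mathlib: `Subring.exists_le_valuationSubring_of_isIntegrallyClosedIn`).

* `exists_scaled_poly` — for `x ∈ l` there is a polynomial `q ∈ k°[X]` with `q(x) = 0` having
  a coefficient of value `1` (scale the minimal polynomial by a coefficient of maximal value).
* `exists_unit_mul_mem_forall` (**Bourbaki VI §8 Prop. 6**, "`W = N_𝔪`") — if `W ∩ k = k°` and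
  `x ∈ W` then there is `y` with `|y|_W = 1` such that `y` and `xy` lie in every `U ∈ 𝒰` (i.e.
  in `N`): with `q = Σ aᵢ Xⁱ` as above and `s` the last index with `|a_s| = 1`, take
  `y = Σ_{i ≥ s} aᵢ x^{i-s}`; if `x ∈ U` this is clear, and if `x ∉ U` then
  `y = -Σ_{i<s} aᵢ (x⁻¹)^{s-i}` with `x⁻¹ ∈ U`.
* `valuationSubring_eq_of_le_of_comap_eq'` — two COMPARABLE valuation rings of `l` over the
  same `k°` are equal (`l/k` algebraic): for `b ∈ 𝔪_{W₁}` a unit of `W₂ ⊇ W₁`, every polynomial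
  over `k°` with `|q(b)|_{W₂} < 1` has all its coefficients in `𝔪_{k°}` (induction via
  `q = X·divX q + q₀`), contradicting `exists_scaled_poly`.
* `finsetCard_le_finrank_of_comap_eq`, `finite_setOf_comap_eq`,
  `ncard_setOf_comap_eq_le_finrank`, `exists_finset_mem_iff_comap_eq` (finiteness of the set
  `E(k°)` of extensions — Datta 2023, Prop. 3.6 (1) — here with the bound `#E(k°) ≤ [l : k]`):
  for distinct
  `W₀, …, W_n ∈ E(k°)` one finds `dᵢ ∈ N`, a unit in `Wᵢ` and in `𝔪_{W_j}` for `j ≠ i`; these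
  are `k`-linearly independent.
* `finite_overrings_of_ringKrullDim_lt_top` — a valuation ring of finite Krull dimension has
  finitely many coarsenings; hence (`finite_setOf_le_comap`) `𝒰` is finite when `k°` has
  finite height.
* `exists_pow_eq_mul_of_forall_lt_one` — in a valuation ring `U`, if `f` lies in the maximal
  ideal of every coarsening of `U` whose maximal ideal contains `b ≠ 0`, then `fⁿ ∈ bU` for
  some `n` (`√(bU)` is the intersection of the primes containing `b`).
* `Temkin2013_valuationRingOpen_holds` — assembly: let `f` be the product, over the finitely
  many `U ∈ 𝒰` for which this is possible, of an element of `N ∩ 𝔪_U ∩ W^×`. For `x ∈ W` write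
  `x = a/b` with `a, b ∈ N`, `b ∈ W^×` (Prop. 6); every `U' ∈ 𝒰` with `b ∈ 𝔪_{U'}` contributes a
  factor of `f` in `𝔪_{U'}`, so `fⁿ = bc` with `c ∈ ⋂ 𝒰 = N`, and `x = ac/fⁿ`.

## Sources

* M. Temkin, *Inseparable local uniformization*, arXiv:0804.1554v3, proof of Thm. 4.1.1, Step 3
  (p. 49).
* N. Bourbaki, *Algèbre commutative*, Ch. VI, §8, no. 6, Prop. 6 (as cited by R. Datta,
  *Essential finite generation of extensions of valuation rings*, Math. Nachr. 296 (2023) =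
  arXiv:2101.08337, §3, p. 8, together with Prop. 3.6 (1) there for the finiteness); the
  integral closure of a subring of a field is the intersection of the valuation rings containing
  it (Mathlib `Subring.exists_le_valuationSubring_of_isIntegrallyClosedIn`).
-/

noncomputable section

open Polynomial

namespace Literature.AlgebraicGeometry.Resolution

universe u

section General

variable {k : Type*} {l : Type*} [Field k] [Field l] [Algebra k l]

/-! ### Valuation rings over a given valuation ring of the base field -/

/-- If `W ∩ k = O'` then `O'` maps into `W`. [folklore] -/
theorem algebraMap_mem_of_comap_eq {O' : ValuationSubring k} {W : ValuationSubring l}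
    (hW : W.comap (algebraMap k l) = O') {c : k} (hc : c ∈ O') : algebraMap k l c ∈ W := by
  rw [← hW] at hc
  exact hc

/-- If `W ∩ k = O'` then `|c|_W ≤ 1 ↔ c ∈ O'` for `c ∈ k`. [folklore] -/
theorem valuation_algebraMap_le_one_iff {O' : ValuationSubring k} {W : ValuationSubring l}
    (hW : W.comap (algebraMap k l) = O') (c : k) :
    W.valuation (algebraMap k l c) ≤ 1 ↔ c ∈ O' := by
  rw [ValuationSubring.valuation_le_one_iff, ← hW]
  rfl

/-- If `W ∩ k = O'` then `W` dominates `O'`: `|c|_W < 1 ↔ |c|_{O'} < 1` for `c ∈ k`. [folklore] -/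
theorem valuation_algebraMap_lt_one_iff {O' : ValuationSubring k} {W : ValuationSubring l}
    (hW : W.comap (algebraMap k l) = O') (c : k) :
    W.valuation (algebraMap k l c) < 1 ↔ O'.valuation c < 1 := by
  rw [← ValuationSubring.mem_nonunits_iff, ← ValuationSubring.mem_nonunits_iff,
    ValuationSubring.mem_nonunits_iff_or, ValuationSubring.mem_nonunits_iff_or, ← map_inv₀,
    map_eq_zero_iff _ (algebraMap k l).injective]
  apply or_congr Iff.rfl
  rw [not_iff_not, ← hW]
  rfl

/-- If `W ∩ k = O'` then `|c|_W = 1 ↔ |c|_{O'} = 1` for `c ∈ k`. [folklore] -/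
theorem valuation_algebraMap_eq_one_iff {O' : ValuationSubring k} {W : ValuationSubring l}
    (hW : W.comap (algebraMap k l) = O') (c : k) :
    W.valuation (algebraMap k l c) = 1 ↔ O'.valuation c = 1 := by
  constructor
  · intro h
    have h1 : c ∈ O' := (valuation_algebraMap_le_one_iff hW c).mp h.le
    have h2 : ¬ O'.valuation c < 1 := fun hlt =>
      (lt_irrefl (1 : W.ValueGroup)) (by
        have := (valuation_algebraMap_lt_one_iff hW c).mpr hlt
        rwa [h] at this)
    exact le_antisymm ((O'.valuation_le_one_iff c).mpr h1) (not_lt.mp h2)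
  · intro h
    have h1 : W.valuation (algebraMap k l c) ≤ 1 :=
      (valuation_algebraMap_le_one_iff hW c).mpr ((O'.valuation_le_one_iff c).mp h.le)
    have h2 : ¬ W.valuation (algebraMap k l c) < 1 := fun hlt =>
      (lt_irrefl (1 : O'.ValueGroup)) (by
        have := (valuation_algebraMap_lt_one_iff hW c).mp hlt
        rwa [h] at this)
    exact le_antisymm h1 (not_lt.mp h2)

/-- For a coarsening `W₁ ≤ W₂`, the maximal ideal of `W₂` is contained in that of `W₁`.
[folklore] -/
theorem valuation_lt_one_of_le {W₁ W₂ : ValuationSubring l} (hle : W₁ ≤ W₂) {z : l}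
    (hz : W₂.valuation z < 1) : W₁.valuation z < 1 := by
  rw [← ValuationSubring.mem_nonunits_iff] at hz ⊢
  exact (ValuationSubring.nonunits_le_nonunits.mpr hle) hz

/-- An element of value one is a unit: its inverse lies in the valuation ring. [folklore] -/
theorem inv_mem_valuationSubring_of_valuation_eq_one {U : ValuationSubring l} {z : l} (hz : U.valuation z = 1) :
    z⁻¹ ∈ U := by
  rw [← U.valuation_le_one_iff, map_inv₀, hz, inv_one]

/-- An element of value one lies in the valuation ring. [folklore] -/
theorem mem_of_valuation_eq_one {U : ValuationSubring l} {z : l} (hz : U.valuation z = 1) :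
    z ∈ U := by
  rw [← U.valuation_le_one_iff, hz]

/-! ### Scaling the minimal polynomial -/

/-- For `x` integral over `k` and a valuation ring `O'` of `k` there is a polynomial over `O'`
annihilating `x` one of whose coefficients has value `1`: divide the minimal polynomial by a
coefficient of maximal value. [folklore] -/
theorem exists_scaled_poly (O' : ValuationSubring k) {x : l} (hx : IsIntegral k x) :
    ∃ q : k[X], aeval x q = 0 ∧ (∀ i, q.coeff i ∈ O') ∧
      ∃ i₀, i₀ ≤ q.natDegree ∧ O'.valuation (q.coeff i₀) = 1 := by
  classical
  set p := minpoly k x with hp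
  have hpx : aeval x p = 0 := minpoly.aeval k x
  have hmo : p.Monic := minpoly.monic hx
  set d := p.natDegree with hd
  obtain ⟨i₀, hi₀, hmax⟩ := Finset.exists_max_image (Finset.range (d + 1))
    (fun i => O'.valuation (p.coeff i)) ⟨d, Finset.self_mem_range_succ d⟩
  set c := p.coeff i₀ with hc
  have hcd : (1 : O'.ValueGroup) ≤ O'.valuation c := by
    have := hmax d (Finset.self_mem_range_succ d)
    have hlead : p.coeff d = 1 := hmo.coeff_natDegree
    rwa [hlead, map_one] at this
  have hvc : 0 < O'.valuation c := lt_of_lt_of_le zero_lt_one hcd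
  have hc0 : c ≠ 0 := fun h0 => (ne_of_gt hvc) (by rw [h0, map_zero])
  refine ⟨C c⁻¹ * p, ?_, ?_, i₀, ?_, ?_⟩
  · rw [map_mul, hpx, mul_zero]
  · intro i
    rw [coeff_C_mul, ← O'.valuation_le_one_iff, map_mul, map_inv₀, inv_mul_le_iff₀ hvc, mul_one]
    by_cases hi : i ∈ Finset.range (d + 1)
    · exact hmax i hi
    · have : p.coeff i = 0 := by
        apply Polynomial.coeff_eq_zero_of_natDegree_lt
        simpa [Finset.mem_range, Nat.lt_succ_iff, not_le] using hi
      rw [this, map_zero]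
      exact zero_le
  · rw [natDegree_C_mul (inv_ne_zero hc0)]
    simpa [Finset.mem_range, Nat.lt_succ_iff] using hi₀
  · rw [coeff_C_mul, ← hc, inv_mul_cancel₀ hc0, map_one]

/-! ### Bourbaki VI §8 Prop. 6: `W = N_𝔪` -/

/-- **A valuation ring of an algebraic extension is the localization of the integral closure
of the base valuation ring** (Bourbaki, *Alg. comm.* VI §8 no. 6 Prop. 6), valuative form: if
`W ∩ k = O'` and `x ∈ W` then there is `y ∈ l` with `|y|_W = 1` such that `y` and `x·y` lie in
every valuation ring `U` of `l` containing `O'`, i.e. (AM 5.22) are integral over `O'`; thus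
`x = (xy)/y` is a quotient of integral elements with unit denominator. PROVED. [folklore] -/
theorem exists_unit_mul_mem_forall [Algebra.IsAlgebraic k l] {O' : ValuationSubring k}
    {W : ValuationSubring l} (hW : W.comap (algebraMap k l) = O') {x : l} (hx : x ∈ W) :
    ∃ y : l, W.valuation y = 1 ∧
      ∀ U : ValuationSubring l, O' ≤ U.comap (algebraMap k l) → y ∈ U ∧ x * y ∈ U := by
  classical
  have hxi : IsIntegral k x := Algebra.IsIntegral.isIntegral x
  obtain ⟨q, hqx, hqO, i₀, hi₀, hvi₀⟩ := exists_scaled_poly O' hxi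
  set d := q.natDegree with hd
  set v := O'.valuation with hv
  -- the last index `s` with `|a_s| = 1`
  set T := (Finset.range (d + 1)).filter (fun i => v (q.coeff i) = 1) with hT
  have hTne : T.Nonempty :=
    ⟨i₀, Finset.mem_filter.mpr ⟨Finset.mem_range.mpr (Nat.lt_succ_of_le hi₀), hvi₀⟩⟩
  set s := T.max' hTne with hs
  have hsT : s ∈ T := Finset.max'_mem T hTne
  have hsd : s ≤ d := Nat.lt_succ_iff.mp (Finset.mem_range.mp (Finset.mem_filter.mp hsT).1)
  have hvs : v (q.coeff s) = 1 := (Finset.mem_filter.mp hsT).2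
  have hlt : ∀ i, s < i → v (q.coeff i) < 1 := by
    intro i hi
    refine lt_of_le_of_ne ((O'.valuation_le_one_iff _).mpr (hqO i)) fun h1 => ?_
    by_cases hir : i ∈ Finset.range (d + 1)
    · have : i ≤ s := Finset.le_max' T i (Finset.mem_filter.mpr ⟨hir, h1⟩)
      omega
    · have : q.coeff i = 0 := by
        apply Polynomial.coeff_eq_zero_of_natDegree_lt
        simpa [Finset.mem_range, Nat.lt_succ_iff, not_le] using hir
      rw [this, map_zero] at h1
      exact zero_ne_one h1
  -- images of the coefficients in `l`
  set A : ℕ → l := fun i => algebraMap k l (q.coeff i) with hA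
  have heq : ∑ i ∈ Finset.range (d + 1), A i * x ^ i = 0 := by
    rw [Polynomial.aeval_eq_sum_range] at hqx
    simpa [Algebra.smul_def] using hqx
  -- the element `y`
  set y : l := ∑ i ∈ Finset.Ico s (d + 1), A i * x ^ (i - s) with hy
  have hxy : x ^ s * y = ∑ i ∈ Finset.Ico s (d + 1), A i * x ^ i := by
    rw [hy, Finset.mul_sum]
    refine Finset.sum_congr rfl fun i hi => ?_
    have hsi : s ≤ i := (Finset.mem_Ico.mp hi).1
    rw [mul_left_comm, ← pow_add, Nat.add_sub_cancel' hsi]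
  have hsplit : ∑ i ∈ Finset.range s, A i * x ^ i + x ^ s * y = 0 := by
    rw [hxy, Finset.sum_range_add_sum_Ico _ (by omega : s ≤ d + 1), heq]
  refine ⟨y, ?_, ?_⟩
  · -- `|y|_W = 1`: the term `i = s` has value `1`, the others value `< 1`
    have hsI : s ∈ Finset.Ico s (d + 1) := Finset.mem_Ico.mpr ⟨le_rfl, Nat.lt_succ_of_le hsd⟩
    rw [hy, ← Finset.add_sum_erase _ _ hsI, Nat.sub_self, pow_zero, mul_one]
    have hAs : W.valuation (A s) = 1 := (valuation_algebraMap_eq_one_iff hW _).mpr hvs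
    rw [Valuation.map_add_eq_of_lt_left]
    · exact hAs
    · rw [hAs]
      apply Valuation.map_sum_lt _ one_ne_zero
      intro i hi
      have hi' : s < i := by
        have h1 := Finset.mem_erase.mp hi
        have h2 := (Finset.mem_Ico.mp h1.2).1
        omega
      rw [map_mul, map_pow]
      have hxle : W.valuation x ≤ 1 := (W.valuation_le_one_iff x).mpr hx
      calc W.valuation (A i) * W.valuation x ^ (i - s)
          ≤ W.valuation (A i) * 1 := by
            gcongr
            exact pow_le_one₀ zero_le hxle
        _ < 1 := by
          rw [mul_one]
          exact (valuation_algebraMap_lt_one_iff hW _).mpr (hlt i hi')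
  · intro U hU
    have hAU : ∀ i, A i ∈ U := fun i => hU (hqO i)
    by_cases hxU : x ∈ U
    · have hyU : y ∈ U := by
        rw [hy]
        exact sum_mem fun i _ => mul_mem (hAU i) (pow_mem hxU _)
      exact ⟨hyU, mul_mem hxU hyU⟩
    · have hx0 : x ≠ 0 := by
        rintro rfl
        exact hxU (zero_mem U)
      have ht : x⁻¹ ∈ U := (U.mem_or_inv_mem x).resolve_left hxU
      have hy' : y = -∑ i ∈ Finset.range s, A i * x⁻¹ ^ (s - i) := by
        have h1 : x ^ s * y = -∑ i ∈ Finset.range s, A i * x ^ i :=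
          eq_neg_of_add_eq_zero_right hsplit
        have h2 : y = (x ^ s)⁻¹ * (x ^ s * y) := by
          rw [← mul_assoc, inv_mul_cancel₀ (pow_ne_zero _ hx0), one_mul]
        rw [h2, h1, mul_neg, Finset.mul_sum]
        congr 1
        refine Finset.sum_congr rfl fun i hi => ?_
        have his : i < s := Finset.mem_range.mp hi
        have hxs : x ^ s = x ^ i * x ^ (s - i) := by rw [← pow_add, Nat.add_sub_cancel' his.le]
        rw [hxs, inv_pow]
        field_simp
      have hyU : y ∈ U := by
        rw [hy']
        exact neg_mem (sum_mem fun i _ => mul_mem (hAU i) (pow_mem ht _))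
      have hxyU : x * y ∈ U := by
        have : x * y = -∑ i ∈ Finset.range s, A i * x⁻¹ ^ (s - i - 1) := by
          rw [hy', mul_neg, Finset.mul_sum]
          congr 1
          refine Finset.sum_congr rfl fun i hi => ?_
          have his : i < s := Finset.mem_range.mp hi
          obtain ⟨m, hm⟩ : ∃ m, s - i = m + 1 := ⟨s - i - 1, by omega⟩
          rw [hm, Nat.add_sub_cancel, pow_succ]
          field_simp
        rw [this]
        exact neg_mem (sum_mem fun i _ => mul_mem (hAU i) (pow_mem ht _))
      exact ⟨hyU, hxyU⟩

/-- Consequence: under the same hypotheses a second valuation ring `W'` of `l` containing `O'`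
contains `W` as soon as every element which is integral (lies in all `U ⊇ O'`) and a unit of `W`
is a unit of `W'`. [folklore] -/
theorem le_of_forall_unit [Algebra.IsAlgebraic k l] {O' : ValuationSubring k}
    {W W' : ValuationSubring l} (hW : W.comap (algebraMap k l) = O')
    (hW' : O' ≤ W'.comap (algebraMap k l))
    (h : ∀ y : l, (∀ U : ValuationSubring l, O' ≤ U.comap (algebraMap k l) → y ∈ U) →
      W.valuation y = 1 → W'.valuation y = 1) :
    W ≤ W' := by
  intro x hx
  obtain ⟨y, hy1, hyU⟩ := exists_unit_mul_mem_forall hW hx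
  have hy' : W'.valuation y = 1 := h y (fun U hU => (hyU U hU).1) hy1
  have hy0 : y ≠ 0 := fun h0 => by
    rw [h0, map_zero] at hy1
    exact zero_ne_one hy1
  have : x = x * y * y⁻¹ := by rw [mul_assoc, mul_inv_cancel₀ hy0, mul_one]
  rw [this]
  exact mul_mem (hyU W' hW').2 (inv_mem_valuationSubring_of_valuation_eq_one hy')

/-! ### Incomparability of the extensions -/

/-- Auxiliary induction: if `W₁ ≤ W₂` lie over the same `O'`, `b ∈ 𝔪_{W₁}` is a unit of `W₂`,
and `q ∈ O'[X]` satisfies `|q(b)|_{W₂} < 1`, then all coefficients of `q` lie in `𝔪_{O'}`.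
[folklore] -/
theorem valuation_coeff_lt_one_of_aeval {O' : ValuationSubring k} {W₁ W₂ : ValuationSubring l}
    (hle : W₁ ≤ W₂) (h₁ : W₁.comap (algebraMap k l) = O') (h₂ : W₂.comap (algebraMap k l) = O')
    {b : l} (hb₁ : W₁.valuation b < 1) (hb₂ : W₂.valuation b = 1) (n : ℕ) :
    ∀ q : k[X], q.natDegree ≤ n → (∀ i, q.coeff i ∈ O') →
      W₂.valuation (aeval b q) < 1 → ∀ i, O'.valuation (q.coeff i) < 1 := by
  induction n with
  | zero =>
    intro q hq hco hval i
    have hq0 : q = C (q.coeff 0) := Polynomial.eq_C_of_natDegree_le_zero hq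
    cases i with
    | zero =>
      rw [hq0, aeval_C] at hval
      exact (valuation_algebraMap_lt_one_iff h₂ _).mp hval
    | succ i =>
      have : q.coeff (i + 1) = 0 := by
        rw [hq0, coeff_C]
        simp
      rw [this, map_zero]
      exact zero_lt_one
  | succ n ih =>
    intro q hq hco hval
    have hb₁W : b ∈ W₁ := (W₁.valuation_le_one_iff b).mp hb₁.le
    set r := aeval b q.divX with hr
    have hdecomp : aeval b q = r * b + algebraMap k l (q.coeff 0) := by
      conv_lhs => rw [← Polynomial.divX_mul_X_add q]
      rw [map_add, map_mul, aeval_X, aeval_C]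
    have hrW₁ : r ∈ W₁ := by
      rw [hr, Polynomial.aeval_eq_sum_range]
      refine sum_mem fun i _ => ?_
      rw [Algebra.smul_def]
      refine mul_mem (algebraMap_mem_of_comap_eq h₁ ?_) (pow_mem hb₁W _)
      rw [coeff_divX]
      exact hco _
    have hval₁ : W₁.valuation (aeval b q) < 1 := valuation_lt_one_of_le hle hval
    have hc0 : O'.valuation (q.coeff 0) < 1 := by
      have e : algebraMap k l (q.coeff 0) = aeval b q - r * b := by
        rw [hdecomp]
        ring
      have : W₁.valuation (algebraMap k l (q.coeff 0)) < 1 := by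
        rw [e]
        refine Valuation.map_sub_lt _ hval₁ ?_
        rw [map_mul]
        have hr1 : W₁.valuation r ≤ 1 := (W₁.valuation_le_one_iff r).mpr hrW₁
        calc W₁.valuation r * W₁.valuation b ≤ 1 * W₁.valuation b := by gcongr
          _ < 1 := by rw [one_mul]; exact hb₁
      exact (valuation_algebraMap_lt_one_iff h₁ _).mp this
    have hr₂ : W₂.valuation r < 1 := by
      have e : r * b = aeval b q - algebraMap k l (q.coeff 0) := by
        rw [hdecomp]
        ring
      have h1 : W₂.valuation (r * b) < 1 := by
        rw [e]
        exact Valuation.map_sub_lt _ hval ((valuation_algebraMap_lt_one_iff h₂ _).mpr hc0)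
      rwa [map_mul, hb₂, mul_one] at h1
    have hdeg : q.divX.natDegree ≤ n := by
      rw [natDegree_divX_eq_natDegree_tsub_one]
      omega
    have hco' : ∀ i, q.divX.coeff i ∈ O' := fun i => by
      rw [coeff_divX]
      exact hco _
    have ih' := ih q.divX hdeg hco' hr₂
    intro i
    cases i with
    | zero => exact hc0
    | succ i =>
      have := ih' i
      rwa [coeff_divX] at this

/-- **Extensions of a valuation ring to an algebraic extension are pairwise incomparable**:
if `W₁ ≤ W₂` are valuation rings of `l` with `W₁ ∩ k = W₂ ∩ k = O'` and `l/k` is algebraic,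
then `W₁ = W₂`. PROVED: otherwise pick `b ∈ 𝔪_{W₁}` a unit of `W₂`; the scaled minimal
polynomial of `b` (`exists_scaled_poly`) has a coefficient of value `1`, contradicting
`valuation_coeff_lt_one_of_aeval`. [folklore] -/
theorem valuationSubring_eq_of_le_of_comap_eq' [Algebra.IsAlgebraic k l] {O' : ValuationSubring k}
    {W₁ W₂ : ValuationSubring l} (hle : W₁ ≤ W₂)
    (h₁ : W₁.comap (algebraMap k l) = O') (h₂ : W₂.comap (algebraMap k l) = O') : W₁ = W₂ := by
  refine le_antisymm hle fun z hz₂ => ?_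
  by_contra hz₁
  have hz0 : z ≠ 0 := by
    rintro rfl
    exact hz₁ (zero_mem _)
  have hz1 : 1 < W₁.valuation z := lt_of_not_ge fun h => hz₁ ((W₁.valuation_le_one_iff z).mp h)
  set b := z⁻¹ with hb
  have hb₁ : W₁.valuation b < 1 := (Valuation.one_lt_val_iff _ hz0).mp hz1
  have hbW₂ : b ∈ W₂ := hle ((W₁.valuation_le_one_iff b).mp hb₁.le)
  have hb₂ : W₂.valuation b = 1 := by
    apply le_antisymm ((W₂.valuation_le_one_iff b).mpr hbW₂)
    have hvz : W₂.valuation z ≤ 1 := (W₂.valuation_le_one_iff z).mpr hz₂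
    have hvz0 : 0 < W₂.valuation z := (Valuation.pos_iff _).mpr hz0
    rw [hb, map_inv₀]
    exact (one_le_inv₀ hvz0).mpr hvz
  have hbi : IsIntegral k b := Algebra.IsIntegral.isIntegral b
  obtain ⟨q, hqb, hqO, i₀, -, hvi₀⟩ := exists_scaled_poly O' hbi
  have hval : W₂.valuation (aeval b q) < 1 := by
    rw [hqb, map_zero]
    exact zero_lt_one
  have := valuation_coeff_lt_one_of_aeval hle h₁ h₂ hb₁ hb₂ q.natDegree q le_rfl hqO hval i₀
  rw [hvi₀] at this
  exact lt_irrefl _ this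

/-- Incomparability, unordered form: two valuation rings of `l` over the same `O'` one of which
contains the other coincide; hence distinct ones are incomparable. [folklore] -/
theorem valuationSubring_eq_of_comap_eq_of_le_or_ge [Algebra.IsAlgebraic k l]
    {O' : ValuationSubring k} {W₁ W₂ : ValuationSubring l}
    (h₁ : W₁.comap (algebraMap k l) = O') (h₂ : W₂.comap (algebraMap k l) = O')
    (h : W₁ ≤ W₂ ∨ W₂ ≤ W₁) : W₁ = W₂ := by
  rcases h with h | h
  · exact valuationSubring_eq_of_le_of_comap_eq' h h₁ h₂
  · exact (valuationSubring_eq_of_le_of_comap_eq' h h₂ h₁).symm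

/-! ### Finiteness of the set of extensions -/

/-- Separation: for distinct valuation rings `Wᵢ ≠ Wⱼ` of `l` over `O'` there is an element
lying in every valuation ring `U ⊇ O'` (an integral element) which is in `𝔪_{Wᵢ}` and is a unit
of `Wⱼ`. [folklore] -/
theorem exists_forall_mem_lt_one_eq_one [Algebra.IsAlgebraic k l] {O' : ValuationSubring k}
    {Wi Wj : ValuationSubring l} (hi : Wi.comap (algebraMap k l) = O')
    (hj : Wj.comap (algebraMap k l) = O') (hne : Wi ≠ Wj) :
    ∃ e : l, (∀ U : ValuationSubring l, O' ≤ U.comap (algebraMap k l) → e ∈ U) ∧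
      Wi.valuation e < 1 ∧ Wj.valuation e = 1 := by
  by_contra H
  push Not at H
  -- then every integral unit of `Wj`... we show `Wj ≤ Wi`
  have hle : Wj ≤ Wi := by
    refine le_of_forall_unit hj (le_of_eq hi.symm) fun y hyU hy1 => ?_
    -- `y ∈ Wi`; if `|y|_{Wi} < 1` then `H` gives `|y|_{Wj} ≠ 1`, contradiction
    have hyi : y ∈ Wi := hyU Wi (le_of_eq hi.symm)
    rcases ((Wi.valuation_le_one_iff y).mpr hyi).lt_or_eq with hlt | heq
    · exact absurd hy1 (H y hyU hlt)
    · exact heq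
  exact hne (valuationSubring_eq_of_le_of_comap_eq' hle hj hi).symm

/-- **At most `[l : k]` extensions** (the weak form `#E ≤ [l : k]` of the fundamental
inequality; cf. Datta 2023, Prop. 3.6 (1)): for `l/k` finite and a valuation ring `O'` of `k`, any
finite set of
valuation rings `W` of `l` with `W ∩ k = O'` has at most `[l : k]` elements. PROVED: distinct
extensions `Wᵢ` yield integral elements `dᵢ`, units in `Wᵢ` and in `𝔪_{W_j}` for `j ≠ i`
(products of the separating elements of `exists_forall_mem_lt_one_eq_one`), and these are
linearly independent over `k`: in a relation `Σ cᵢ dᵢ = 0` divide by a coefficient `c_{i₀}` of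
maximal value and read it in `W_{i₀}`. [folklore] -/
theorem finsetCard_le_finrank_of_comap_eq [FiniteDimensional k l] (O' : ValuationSubring k)
    (t : Finset (ValuationSubring l)) (hmem : ∀ W ∈ t, W.comap (algebraMap k l) = O') :
    t.card ≤ Module.finrank k l := by
  classical
  -- separating elements
  have hsep : ∀ Wi ∈ t, ∀ Wj ∈ t, Wi ≠ Wj → ∃ e : l,
      (∀ U : ValuationSubring l, O' ≤ U.comap (algebraMap k l) → e ∈ U) ∧
        Wi.valuation e < 1 ∧ Wj.valuation e = 1 :=
    fun Wi hWi Wj hWj hne => exists_forall_mem_lt_one_eq_one (hmem Wi hWi) (hmem Wj hWj) hne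
  choose! e he using hsep
  -- `d W = ∏_{W' ≠ W} e W' W`: integral, unit in `W`, in `𝔪_{W'}` for `W' ≠ W`
  set d : ValuationSubring l → l := fun W => ∏ W' ∈ t.erase W, e W' W with hd
  have hdU : ∀ W ∈ t, ∀ U : ValuationSubring l, O' ≤ U.comap (algebraMap k l) → d W ∈ U := by
    intro W hW U hU
    refine prod_mem fun W' hW' => ?_
    have h' := Finset.mem_erase.mp hW'
    exact (he W' h'.2 W hW h'.1).1 U hU
  have hd1 : ∀ W ∈ t, W.valuation (d W) = 1 := by
    intro W hW
    rw [hd]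
    simp only [map_prod]
    refine Finset.prod_eq_one fun W' hW' => ?_
    have h' := Finset.mem_erase.mp hW'
    exact (he W' h'.2 W hW h'.1).2.2
  have hdlt : ∀ W ∈ t, ∀ W' ∈ t, W' ≠ W → W'.valuation (d W) < 1 := by
    intro W hW W' hW' hne
    rw [hd]
    simp only [map_prod]
    rw [← Finset.mul_prod_erase _ _ (Finset.mem_erase.mpr ⟨hne, hW'⟩)]
    have h1 : W'.valuation (e W' W) < 1 := (he W' hW' W hW hne).2.1
    have h2 : ∏ x ∈ (t.erase W).erase W', W'.valuation (e x W) ≤ 1 := by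
      refine Finset.prod_le_one' fun W'' hW'' => ?_
      have h'' := Finset.mem_erase.mp (Finset.mem_erase.mp hW'').2
      exact (W'.valuation_le_one_iff _).mpr
        ((he W'' h''.2 W hW h''.1).1 W' (le_of_eq (hmem W' hW').symm))
    calc W'.valuation (e W' W) * ∏ x ∈ (t.erase W).erase W', W'.valuation (e x W)
        ≤ W'.valuation (e W' W) * 1 := by gcongr
      _ < 1 := by rwa [mul_one]
  -- linear independence of `d` on `t`
  have hli : LinearIndependent k (fun W : t => d W.1) := by
    rw [Fintype.linearIndependent_iff]
    intro g hg
    by_contra hne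
    push Not at hne
    obtain ⟨i₁, hi₁⟩ := hne
    obtain ⟨i₀, -, hmax⟩ := Finset.exists_max_image Finset.univ (fun i : t => O'.valuation (g i))
      ⟨i₁, Finset.mem_univ _⟩
    have hg0 : g i₀ ≠ 0 := by
      intro h0
      apply hi₁
      have := hmax i₁ (Finset.mem_univ _)
      rw [h0, map_zero, le_zero_iff] at this
      exact (Valuation.zero_iff _).mp this
    set W₀ : ValuationSubring l := i₀.1 with hW₀
    have hW₀t : W₀ ∈ t := i₀.2
    have hrel : d W₀ = -∑ i ∈ Finset.univ.erase i₀, ((g i₀)⁻¹ * g i) • d i.1 := by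
      have h1 := Finset.add_sum_erase Finset.univ (fun i : t => g i • d i.1) (Finset.mem_univ i₀)
      rw [hg] at h1
      have h2 : g i₀ • d W₀ = -∑ i ∈ Finset.univ.erase i₀, g i • d i.1 :=
        eq_neg_of_add_eq_zero_left h1
      have h3 : d W₀ = (g i₀)⁻¹ • (g i₀ • d W₀) := by
        rw [smul_smul, inv_mul_cancel₀ hg0, one_smul]
      rw [h3, h2, smul_neg, Finset.smul_sum]
      simp only [smul_smul]
    have hlt1 : W₀.valuation (d W₀) < 1 := by
      rw [hrel, Valuation.map_neg]
      apply Valuation.map_sum_lt _ one_ne_zero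
      intro i hi
      have hii : i.1 ≠ W₀ := fun h => (Finset.mem_erase.mp hi).1 (Subtype.ext h)
      rw [Algebra.smul_def, map_mul]
      have hc : W₀.valuation (algebraMap k l ((g i₀)⁻¹ * g i)) ≤ 1 := by
        apply (valuation_algebraMap_le_one_iff (hmem W₀ hW₀t) _).mpr
        rw [← O'.valuation_le_one_iff, map_mul, map_inv₀,
          inv_mul_le_iff₀ ((Valuation.pos_iff _).mpr hg0), mul_one]
        exact hmax i (Finset.mem_univ _)
      calc W₀.valuation (algebraMap k l ((g i₀)⁻¹ * g i)) * W₀.valuation (d i.1)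
          ≤ 1 * W₀.valuation (d i.1) := by gcongr
        _ < 1 := by
          rw [one_mul]
          exact hdlt i.1 i.2 W₀ hW₀t hii.symm
    have h1 := hd1 W₀ hW₀t
    rw [h1] at hlt1
    exact lt_irrefl _ hlt1
  have hcard := hli.fintype_card_le_finrank
  rwa [Fintype.card_coe] at hcard

/-- **Finiteness of the extensions of a valuation ring to a finite extension** (Datta 2023,
Prop. 3.6 (1) with Bourbaki VI §8 no. 6 Prop. 6): for `l/k` finite and a valuation ring `O'` of
`k`, the set of
valuation rings `W` of `l` with `W ∩ k = O'` is finite. PROVED from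
`finsetCard_le_finrank_of_comap_eq`. [folklore] -/
theorem finite_setOf_comap_eq [FiniteDimensional k l] (O' : ValuationSubring k) :
    {W : ValuationSubring l | W.comap (algebraMap k l) = O'}.Finite := by
  by_contra hinf
  obtain ⟨t, htE, htcard⟩ := Set.Infinite.exists_subset_card_eq hinf (Module.finrank k l + 1)
  have := finsetCard_le_finrank_of_comap_eq O' t fun W hW => htE (Finset.mem_coe.mpr hW)
  omega

/-- The number of extensions of `O'` to `l` is at most `[l : k]`. [folklore] -/
theorem ncard_setOf_comap_eq_le_finrank [FiniteDimensional k l] (O' : ValuationSubring k) :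
    {W : ValuationSubring l | W.comap (algebraMap k l) = O'}.ncard ≤ Module.finrank k l := by
  rw [Set.ncard_eq_toFinset_card _ (finite_setOf_comap_eq O')]
  refine finsetCard_le_finrank_of_comap_eq O' _ fun W hW => ?_
  have hW' : W ∈ {W : ValuationSubring l | W.comap (algebraMap k l) = O'} :=
    (Set.Finite.mem_toFinset (finite_setOf_comap_eq O')).mp hW
  exact hW'

/-- The extensions of `O'` to `l` form a finite set (as a `Finset`, the shape used in
`IsDefectlessIn`, `ValuationDefect.lean`). [folklore] -/
theorem exists_finset_mem_iff_comap_eq [FiniteDimensional k l] (O' : ValuationSubring k) :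
    ∃ s : Finset (ValuationSubring l), ∀ W, W ∈ s ↔ W.comap (algebraMap k l) = O' :=
  ⟨(finite_setOf_comap_eq O').toFinset, fun W => by simp⟩

/-! ### Finite height: finitely many valuation rings contain `k°` -/

/-- A valuation ring of finite Krull dimension has finitely many coarsenings (its prime ideals
form a finite chain). [folklore] -/
theorem finite_overrings_of_ringKrullDim_lt_top (O : ValuationSubring k)
    (h : ringKrullDim O < ⊤) : Finite {S : ValuationSubring k // O ≤ S} := by
  obtain ⟨n, hn⟩ : ∃ n : ℕ, ringKrullDim O < n := by
    generalize ringKrullDim O = q at h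
    induction q using WithBot.recBotCoe with
    | bot => exact ⟨0, bot_lt_iff_ne_bot.mpr (WithBot.natCast_ne_bot 0)⟩
    | coe m =>
      induction m using ENat.recTopCoe with
      | top => simp at h
      | coe m => exact ⟨m + 1, by exact_mod_cast Nat.lt_succ_self m⟩
  have hdim : Order.krullDim {S : ValuationSubring k // O ≤ S} < n := by
    rw [← Order.krullDim_eq_of_orderIso O.primeSpectrumOrderEquiv, Order.krullDim_orderDual]
    exact hn
  by_contra hinf
  rw [not_finite_iff_infinite] at hinf
  obtain ⟨s, hs⟩ := Infinite.exists_subset_card_eq {S : ValuationSubring k // O ≤ S} (n + 1)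
  have := (Order.krullDim_lt_coe_iff.mp hdim)
    (LTSeries.mk n (fun i => s.orderEmbOfFin hs i) (s.orderEmbOfFin hs).strictMono)
  exact lt_irrefl n this

/-- For `l/k` finite and `k°` of finite height, only finitely many valuation rings of `l`
contain `k°`: each lies over one of the finitely many coarsenings of `k°`, and over each of
these there are finitely many (`finite_setOf_comap_eq`). [folklore] -/
theorem finite_setOf_le_comap [FiniteDimensional k l] (Ok : ValuationSubring k)
    (h : ringKrullDim Ok < ⊤) :
    {U : ValuationSubring l | Ok ≤ U.comap (algebraMap k l)}.Finite := by
  haveI := finite_overrings_of_ringKrullDim_lt_top Ok h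
  have hU : {U : ValuationSubring l | Ok ≤ U.comap (algebraMap k l)} =
      ⋃ S : {S : ValuationSubring k // Ok ≤ S},
        {U : ValuationSubring l | U.comap (algebraMap k l) = S.1} := by
    ext U
    simp only [Set.mem_setOf_eq, Set.mem_iUnion]
    exact ⟨fun hU => ⟨⟨_, hU⟩, rfl⟩, fun ⟨S, hS⟩ => hS ▸ S.2⟩
  rw [hU]
  exact Set.finite_iUnion fun S => finite_setOf_comap_eq S.1

/-! ### The radical step inside one valuation ring -/

/-- In a valuation ring `U` of `l`: if `f ∈ U` lies in the maximal ideal of every coarsening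
`U' ⊇ U` whose maximal ideal contains `b ∈ U ∖ 0`, then `fⁿ ∈ bU` for some `n` — `f` lies in
every prime of `U` containing `b`, i.e. in `√(bU)`. [folklore] -/
theorem exists_pow_eq_mul_of_forall_lt_one (U : ValuationSubring l) {b f : l} (hb : b ∈ U)
    (hf : f ∈ U)
    (H : ∀ U' : ValuationSubring l, U ≤ U' → U'.valuation b < 1 → U'.valuation f < 1) :
    ∃ (n : ℕ) (c : l), c ∈ U ∧ f ^ n = b * c := by
  set b' : U := ⟨b, hb⟩ with hb'
  set f' : U := ⟨f, hf⟩ with hf'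
  have key : ∀ (P : Ideal U) [P.IsPrime] (z : U),
      z ∈ P ↔ (U.ofPrime P).valuation (z : l) < 1 := by
    intro P _ z
    have e : z ∈ U.idealOfLE (U.ofPrime P) (U.le_ofPrime P) ↔ z ∈ P := by
      rw [ValuationSubring.idealOfLE_ofPrime]
    rw [← e]
    exact ValuationSubring.valuation_lt_one_iff (U.ofPrime P)
      (U.inclusion (U.ofPrime P) (U.le_ofPrime P) z)
  have hrad : f' ∈ (Ideal.span {b'}).radical := by
    rw [Ideal.radical_eq_sInf, Submodule.mem_sInf]
    rintro P ⟨hbP, hP⟩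
    haveI := hP
    have hbP' : b' ∈ P := hbP (Ideal.subset_span rfl)
    exact (key P f').mpr (H _ (U.le_ofPrime P) ((key P b').mp hbP'))
  obtain ⟨n, hn⟩ := Ideal.mem_radical_iff.mp hrad
  obtain ⟨c', hc'⟩ := Ideal.mem_span_singleton'.mp hn
  refine ⟨n, c', c'.2, ?_⟩
  have := congrArg (fun z : U => (z : l)) hc'
  simp only [hb', hf', SubmonoidClass.coe_pow] at this
  rw [mul_comm] at this
  exact_mod_cast this.symm

end General

/-! ### Assembly -/

/-- **`Temkin2013_valuationRingOpen` holds** (Temkin 2013, proof of Thm. 4.1.1, Step 3, p. 49: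
"`Sᵢ` is open in `Nr_{mᵢ}(S)` (this is even true for any valuation ring of finite height)";
Bourbaki, *Alg. comm.* VI §8 no. 6 Prop. 6, cf. Datta 2023 §3): for `l/k` finite, `k°` of finite
height and `W` a valuation ring of `l` over `k°`, there is `f ∈ l` integral over `k°` and a
unit of `W` with `W = Nr_l(k°)[1/f]`. PROVED (see the module docstring for the argument).
[cite: Temkin2013, proof of Thm. 4.1.1 Step 3 (arXiv:0804.1554v3 p. 49)] -/
theorem Temkin2013_valuationRingOpen_holds : Temkin2013_valuationRingOpen.{u} := by
  intro k l _ _ _ hfin Ok hh W hW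
  classical
  set R : Subring l := Ok.toSubring.map (algebraMap k l) with hR
  have hRU : ∀ U : ValuationSubring l, R ≤ U.toSubring ↔ Ok ≤ U.comap (algebraMap k l) := by
    intro U
    rw [hR, Subring.map_le_iff_le_comap]
    rfl
  -- integrality over `R ≅ k°` ↔ membership in all valuation rings containing `k°`
  have hint : ∀ z : l, IsIntegral R z ↔
      ∀ U : ValuationSubring l, Ok ≤ U.comap (algebraMap k l) → z ∈ U := by
    intro z
    constructor
    · intro hz U hU
      have hRU' : R ≤ U.toSubring := (hRU U).mpr hU
      letI : Algebra R U := (Subring.inclusion hRU').toAlgebra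
      haveI : IsScalarTower R U l := IsScalarTower.of_algebraMap_eq (fun _ => rfl)
      have hz' : IsIntegral U z := hz.tower_top
      obtain ⟨y, rfl⟩ := IsIntegrallyClosed.algebraMap_eq_of_integral hz'
      exact y.2
    · intro hz
      by_contra hzi
      have hzN : z ∉ (integralClosure R l).toSubring := hzi
      obtain ⟨V, hV, hzV⟩ := Subring.exists_le_valuationSubring_of_isIntegrallyClosedIn hzN
      refine hzV (hz V ((hRU V).mp (le_trans ?_ hV)))
      intro r hr
      exact (integralClosure R l).algebraMap_mem ⟨r, hr⟩
  have hUfin := finite_setOf_le_comap (l := l) Ok hh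
  set 𝒰 := {U : ValuationSubring l | Ok ≤ U.comap (algebraMap k l)} with h𝒰
  have hW𝒰 : W ∈ 𝒰 := le_of_eq hW.symm
  -- the factors `q U` of `f`
  have hq : ∀ U : ValuationSubring l, ∃ q : l, (∀ U' ∈ 𝒰, q ∈ U') ∧ W.valuation q = 1 ∧
      ((∃ q' : l, (∀ U' ∈ 𝒰, q' ∈ U') ∧ W.valuation q' = 1 ∧ U.valuation q' < 1) →
        U.valuation q < 1) := by
    intro U
    by_cases h : ∃ q' : l, (∀ U' ∈ 𝒰, q' ∈ U') ∧ W.valuation q' = 1 ∧ U.valuation q' < 1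
    · obtain ⟨q', h1, h2, h3⟩ := h
      exact ⟨q', h1, h2, fun _ => h3⟩
    · exact ⟨1, fun U' _ => one_mem _, map_one _, fun h' => absurd h' h⟩
  choose q hqU hqW hqlt using hq
  set f : l := ∏ U ∈ hUfin.toFinset, q U with hf
  have hfU : ∀ U' ∈ 𝒰, f ∈ U' := fun U' hU' => prod_mem fun U _ => hqU U U' hU'
  have hfW : W.valuation f = 1 := by
    rw [hf, map_prod]
    exact Finset.prod_eq_one fun U _ => hqW U
  have hf0 : f ≠ 0 := fun h0 => by
    rw [h0, map_zero] at hfW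
    exact zero_ne_one hfW
  -- key property: `f ∈ 𝔪_{U'}` whenever some integral unit `b` of `W` lies in `𝔪_{U'}`
  have hfkey : ∀ U' ∈ 𝒰, ∀ b : l, (∀ U'' ∈ 𝒰, b ∈ U'') → W.valuation b = 1 →
      U'.valuation b < 1 → U'.valuation f < 1 := by
    intro U' hU' b hbU hbW hbU'
    have h1 : U'.valuation (q U') < 1 := hqlt U' ⟨b, hbU, hbW, hbU'⟩
    rw [hf, map_prod, ← Finset.mul_prod_erase _ _ (hUfin.mem_toFinset.mpr hU')]
    have h2 : ∏ x ∈ hUfin.toFinset.erase U', U'.valuation (q x) ≤ 1 :=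
      Finset.prod_le_one' fun U _ => (U'.valuation_le_one_iff _).mpr (hqU U U' hU')
    calc U'.valuation (q U') * ∏ x ∈ hUfin.toFinset.erase U', U'.valuation (q x)
        ≤ U'.valuation (q U') * 1 := by gcongr
      _ < 1 := by rwa [mul_one]
  refine ⟨f, (hint f).mpr hfU, mem_of_valuation_eq_one hfW, inv_mem_valuationSubring_of_valuation_eq_one hfW,
    fun x => ⟨fun hx => ?_, ?_⟩⟩
  · haveI : Algebra.IsAlgebraic k l := Algebra.IsAlgebraic.of_finite k l
    obtain ⟨y, hy1, hyU⟩ := exists_unit_mul_mem_forall hW hx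
    have hy0 : y ≠ 0 := fun h0 => by
      rw [h0, map_zero] at hy1
      exact zero_ne_one hy1
    have hyU' : ∀ U' ∈ 𝒰, y ∈ U' := fun U' hU' => (hyU U' hU').1
    have hxyU' : ∀ U' ∈ 𝒰, x * y ∈ U' := fun U' hU' => (hyU U' hU').2
    have hpow : ∀ U : ValuationSubring l, U ∈ 𝒰 →
        ∃ n : ℕ, ∃ c : l, c ∈ U ∧ f ^ n = y * c := by
      intro U hU
      refine exists_pow_eq_mul_of_forall_lt_one U (hyU' U hU) (hfU U hU)
        fun U' hUU' hyU'lt => ?_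
      have hU' : U' ∈ 𝒰 := fun c hc => hUU' ((show Ok ≤ U.comap (algebraMap k l) from hU) hc)
      exact hfkey U' hU' y hyU' hy1 hyU'lt
    choose! nU cU hcU hncU using hpow
    set n := ∑ U ∈ hUfin.toFinset, nU U with hn
    have hnle : ∀ U ∈ 𝒰, nU U ≤ n := fun U hU =>
      Finset.single_le_sum (f := nU) (fun _ _ => Nat.zero_le _) (hUfin.mem_toFinset.mpr hU)
    set c : l := f ^ n / y with hc
    have hcU' : ∀ U ∈ 𝒰, c ∈ U := by
      intro U hU
      have e : c = cU U * f ^ (n - nU U) := by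
        rw [hc, div_eq_iff hy0, show f ^ n = f ^ nU U * f ^ (n - nU U) by
          rw [← pow_add, Nat.add_sub_cancel' (hnle U hU)], hncU U hU]
        ring
      rw [e]
      exact mul_mem (hcU U hU) (pow_mem (hfU U hU) _)
    refine ⟨x * y * c, (hint _).mpr fun U hU => mul_mem (hxyU' U hU) (hcU' U hU), n, ?_⟩
    rw [hc]
    field_simp
  · rintro ⟨a, ha, n, rfl⟩
    exact div_pow_mem_valuationSubring Ok W hW (inv_mem_valuationSubring_of_valuation_eq_one hfW) ha n

end Literature.AlgebraicGeometry.Resolution
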